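import Summits.QuantumFields.YangMills.Theorems.BalabanUVNodesN19SingleModeMomentFirstOrderLadder
import Mathlib.Analysis.SpecialFunctions.Log.Base

/-!
# YM-DAG node N19 (= NE7 proper) — THE FIRST-ORDER TAIL CORRECTION IN THE UNIFORM MIXED-MOMENT CURRENCY, PART C1: the price for laws and
# the parameters ∕ log-mass BUDGET at `L = log r⁻¹` (for PART C2: `|∫cos(ωΣ_{i≤d}|x_i|)d(P − Q)| ≤ 340·ωd∕L + e^{−L∕2}`)

Cell `pub-ymgap`, HUMAN RULING D-0062 (Track A) ∕ D-0149 (work-bound push), R141 (C) wider-strategy seat `pub-ymgap-dag-n19-e` (strategy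
s3 = ALTERNATIVE CURRENCY), generation g32, module 7 (lineage module 145).  Route `Summits/QuantumFields/YangMills/Theses/BalabanUVNodes.lean`,
cluster item K3⁸ «SpineGivenEndpointR13SepCoPHV» (stmt-QuantumFields-27366); filed `--supports` that item `--as helper` (it proves no registered
stub).  COUNT-NEUTRAL: [folklore]∕[bookkeeping] over Mathlib and the lineage BY NAME — PART B `…N19SingleModeMomentFirstOrderLadder`
(`exists_pair_near_cexp_l1Norm_firstOrder_mass`), PART A (`exists_pair_firstOrder_step_mass`), module 128 (`exists_additiveJackson_mass`), module 127
(`abs_integral_eval_sub_le_mass`, `mass_sub_le`, `mass_C_le`), module 119 (`abs_l1Norm_sub_half_le`), modules 65∕62 (`abs_integral_le_of_cube`,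
`integrable_of_continuous_of_cube`); TOY laws under HYPOTHESES, no scheme object, no Theses import; NOT a discharge claim.

CONTENT.  §1 `abs_integral_sub_le_of_near_mass` (the price: `|∫g dP − ∫g dQ| ≤ 2η + 𝓜·r` when `g` is within `η` of a polynomial of mass `≤ 𝓜`) ·
§2 the parameters at budget `L` (`a := ωd`, `Λ₂ := log₂L ≥ 10`, regime `a·Λ₂² ≤ L∕16384`): `exists_scale_L` (when `π²aL > 64`: `J` least with
`π²aL ≤ 64·4^J`; `ρ² ≤ 64a∕L`, `ρ ≤ 1`, `2^J·512Λ₂ < πL`, `2^J ≤ L∕4`, `J + 1 ≤ Λ₂`) · `exists_order_L` (`h = ⌈3 log L⌉`: `e^{−h} ≤ L^{−3}`,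
`h ≤ 2.2Λ₂`) · `logmass_le` (THE BUDGET: PART B's `Λ + log(1 + 2aN9^N) ≤ L∕2` for `N ≤ L∕16` — `log 2 ≤ 0.6932`, `log 81 ≤ 7 log 2`,
`log 9 ≤ 4 log 2`, `e² ≤ 7.4`, `log(1 + 10a) ≤ min(10a, 2 log L)`).  PART C2 (`…N19SingleModeMomentLogFree`) assembles:
**`|∫cos(ωΣ_i|x_i|)dP − ∫cos(ωΣ_i|x_i|)dQ| ≤ 340·ωd∕L + e^{−L∕2}`** for laws with `e^{−L}`-close mixed moments, `L ≥ 1024`, `ωd·(log₂L)² ≤ L∕16384`.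
READING (CURRENCY-MAP v10, honest): the row «UNIFORM MOMENTS `r` → single mode of `d` strings» read `ωd·log2∕(20πL) ≤ · ≤ C·ωd·log²L∕L`
(modules 138 ∕ 129, `L = log r⁻¹`); it is now **`Θ(ωd∕L)` up to an absolute constant** (and the additive `e^{−L∕2}`) in the regime `ωd ≲ L∕log²L` — the
moment-currency twin of modules 139–141: the `log²L` was the Jackson ladder's, not the problem's.  Constants (`340`, `16384`, `1024`) nowhere optimised.

HONEST FRAMING (binding).  Elementary and [folklore]; TOY laws under hypotheses; NO consumer in the DAG today (the seat's own currency map); nothing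
of Bałaban's instantiated; NE7 NOT PRINTED, NOT proved; N19 NOT discharged; count-neutral.  One finite `T⁴` programme at fixed `ε`; nothing continuum ∕
`ℝ⁴` ∕ OS ∕ mass-gap ∕ Clay.  0 `def` ∕ 0 `sorry`.
-/

noncomputable section

open Finset Complex MeasureTheory
open scoped Real

namespace Summit.QuantumFields.YangMills.Theorems.BalabanUVNodesN19SingleModeMomentLogFreeBudget

open Summit.QuantumFields.YangMills.Theorems.BalabanUVNodesN19SingleModeMomentFirstOrderLadder
  (exists_pair_near_cexp_l1Norm_firstOrder_mass)
open Summit.QuantumFields.YangMills.Theorems.BalabanUVNodesN19SingleModeMomentFirstOrder (exists_pair_firstOrder_step_mass)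
open Summit.QuantumFields.YangMills.Theorems.BalabanUVNodesN19SingleModeMomentLadder (exists_additiveJackson_mass)
open Summit.QuantumFields.YangMills.Theorems.BalabanUVNodesN19CoefficientMassPricing
open Summit.QuantumFields.YangMills.Theorems.BalabanUVNodesN19SingleModeL1Norm (abs_l1Norm_sub_half_le)
open Summit.QuantumFields.YangMills.Theorems.BalabanUVNodesN19JointLawPriceDimension (abs_integral_le_of_cube)
open Summit.QuantumFields.YangMills.Theorems.BalabanUVNodesN19JointLawBernstein (integrable_of_continuous_of_cube)

variable {ι : Type*} [Fintype ι]

/-! ## §1 The price for laws with `r`-close mixed moments [folklore] -/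

/-- **THE PRICE.**  If a real `MvPolynomial` `F` is within `η` of a continuous `g` on the cube and has mass `≤ 𝓜`, then for probability laws on `ℝ^ι`
carried by `[−1,1]^ι` with `r`-close mixed moments `|∫g dP − ∫g dQ| ≤ 2η + 𝓜·r` (`∫g = ∫(g − F) + ∫F`; module 127's price for `F`). [folklore] -/
theorem abs_integral_sub_le_of_near_mass {P Q : Measure (ι → ℝ)} [IsProbabilityMeasure P] [IsProbabilityMeasure Q]
    (hP : P (Set.pi Set.univ (fun _ : ι => Set.Icc (-1 : ℝ) 1))ᶜ = 0) (hQ : Q (Set.pi Set.univ (fun _ : ι => Set.Icc (-1 : ℝ) 1))ᶜ = 0)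
    {r : ℝ} (hr : 0 ≤ r) (hmom : ∀ j : ι → ℕ, |∫ x, ∏ i, x i ^ j i ∂P - ∫ x, ∏ i, x i ^ j i ∂Q| ≤ r)
    {g : (ι → ℝ) → ℝ} (hg : Continuous g) {F : MvPolynomial ι ℝ} {η 𝓜 : ℝ}
    (happ : ∀ x : ι → ℝ, (∀ i, x i ∈ Set.Icc (-1 : ℝ) 1) → |g x - MvPolynomial.eval x F| ≤ η)
    (hmass : (∑ s ∈ F.support, |F.coeff s|) ≤ 𝓜) :
    |∫ x, g x ∂P - ∫ x, g x ∂Q| ≤ 2 * η + 𝓜 * r := by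
  have hFc : Continuous fun x : ι → ℝ => MvPolynomial.eval x F := MvPolynomial.continuous_eval F
  have hgF : Continuous fun x : ι → ℝ => g x - MvPolynomial.eval x F := hg.sub hFc
  have hsplit : ∀ (μ : Measure (ι → ℝ)) [IsProbabilityMeasure μ], μ (Set.pi Set.univ (fun _ : ι => Set.Icc (-1 : ℝ) 1))ᶜ = 0 →
      ∫ x, g x ∂μ = ∫ x, (g x - MvPolynomial.eval x F) ∂μ + ∫ x, MvPolynomial.eval x F ∂μ := by
    intro μ _ hμ
    rw [← integral_add (integrable_of_continuous_of_cube hμ hgF) (integrable_of_continuous_of_cube hμ hFc)]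
    refine integral_congr_ae (Filter.Eventually.of_forall fun x => ?_)
    simp only [sub_add_cancel]
  rw [hsplit P hP, hsplit Q hQ, add_sub_add_comm]
  have h1 := abs_integral_le_of_cube hP (f := fun x => g x - MvPolynomial.eval x F) happ
  have h2 := abs_integral_le_of_cube hQ (f := fun x => g x - MvPolynomial.eval x F) happ
  have h3 := abs_integral_eval_sub_le_mass hP hQ hmom F
  calc |(∫ x, (g x - MvPolynomial.eval x F) ∂P - ∫ x, (g x - MvPolynomial.eval x F) ∂Q) +
        (∫ x, MvPolynomial.eval x F ∂P - ∫ x, MvPolynomial.eval x F ∂Q)|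
      ≤ |∫ x, (g x - MvPolynomial.eval x F) ∂P - ∫ x, (g x - MvPolynomial.eval x F) ∂Q| +
        |∫ x, MvPolynomial.eval x F ∂P - ∫ x, MvPolynomial.eval x F ∂Q| := abs_add_le _ _
    _ ≤ (η + η) + (∑ s ∈ F.support, |F.coeff s|) * r := add_le_add ((abs_sub _ _).trans (add_le_add h1 h2)) h3
    _ ≤ 2 * η + 𝓜 * r := by nlinarith [mul_le_mul_of_nonneg_right hmass hr]

/-! ## §2 The parameters at budget `L` [bookkeeping] -/

/-- **THE SCALE AT BUDGET `L`.**  Let `L ≥ 1024`, `a ≥ 0`, `a·(log₂L)² ≤ L∕16384`, `π²aL > 64`, and `J` the least natural with `π²aL ≤ 64·4^J`.  Then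
`(aπ∕2^J)² ≤ 64a∕L`, `aπ ≤ 2^J`, `2^J·512·log₂L < πL` (squares: `(2^J·512Λ₂)² = 16384·16·4^J·Λ₂² < 16384π²aL·Λ₂² ≤ (πL)²`), `2^J ≤ L∕4`,
`J + 1 ≤ log₂L`. [bookkeeping] -/
theorem exists_scale_L {L a : ℝ} (hL : 1024 ≤ L) (ha : 0 ≤ a) (hreg : a * Real.logb 2 L ^ 2 ≤ L / 16384) (hbig : 64 < π ^ 2 * a * L) :
    ∃ J : ℕ, (a * π / 2 ^ J) ^ 2 ≤ 64 * a / L ∧ a * π ≤ 2 ^ J ∧ (2 : ℝ) ^ J * (512 * Real.logb 2 L) < π * L ∧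
      (2 : ℝ) ^ J ≤ L / 4 ∧ (J : ℝ) + 1 ≤ Real.logb 2 L := by
  classical
  set Lb : ℝ := Real.logb 2 L with hLb
  have hL0 : 0 < L := by linarith
  have hπhi : π < 3.15 := Real.pi_lt_d2
  have hLb10 : 10 ≤ Lb := by
    rw [hLb, Real.le_logb_iff_rpow_le one_lt_two hL0]
    have e : (2 : ℝ) ^ (10 : ℝ) = 1024 := by norm_num
    rw [e]; exact hL
  have hex : ∃ J : ℕ, π ^ 2 * a * L ≤ 64 * 4 ^ J := by
    obtain ⟨n, hn⟩ := pow_unbounded_of_one_lt (π ^ 2 * a * L / 64) (by norm_num : (1 : ℝ) < 4)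
    refine ⟨n, ?_⟩
    rw [div_lt_iff₀ (by norm_num : (0 : ℝ) < 64)] at hn
    linarith only [hn]
  set J : ℕ := Nat.find hex with hJ
  have hJspec : π ^ 2 * a * L ≤ 64 * 4 ^ J := Nat.find_spec hex
  have hJpos : 0 < J := by
    rw [Nat.pos_iff_ne_zero]
    intro h0
    have h1 := hJspec
    rw [h0, pow_zero, mul_one] at h1
    linarith only [h1, hbig]
  have hJmin : 64 * (4 : ℝ) ^ (J - 1) < π ^ 2 * a * L := lt_of_not_ge (Nat.find_min hex (show J - 1 < J by omega))
  have h4J : (4 : ℝ) ^ J = 4 * 4 ^ (J - 1) := by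
    rw [← pow_succ']
    congr 1
    omega
  have h16 : 16 * (4 : ℝ) ^ J < π ^ 2 * a * L := by rw [h4J]; linarith only [hJmin]
  have hM2 : ((2 : ℝ) ^ J) ^ 2 = 4 ^ J := by rw [← pow_mul, mul_comm, pow_mul]; norm_num
  have hM0 : (0 : ℝ) < 2 ^ J := by positivity
  have hρsq : (a * π / 2 ^ J) ^ 2 ≤ 64 * a / L := by
    rw [div_pow, mul_pow, hM2, div_le_div_iff₀ (by positivity) hL0]
    have h1 := mul_le_mul_of_nonneg_left hJspec ha
    nlinarith only [h1]
  have ha64 : 64 * a ≤ L := by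
    have h1 : a * 100 ≤ a * Lb ^ 2 := mul_le_mul_of_nonneg_left (by nlinarith only [hLb10]) ha
    linarith only [h1, hreg, hL0]
  have hρ0 : 0 ≤ a * π / 2 ^ J := by positivity
  have hρ1 : a * π / 2 ^ J ≤ 1 := by
    have h1 : (a * π / 2 ^ J) ^ 2 ≤ 1 := hρsq.trans (by rw [div_le_one hL0]; exact ha64)
    nlinarith only [h1, hρ0]
  have hP4 : a * π ≤ 2 ^ J := by rwa [div_le_one hM0] at hρ1
  have hMlt : 2 ^ J * (512 * Lb) < π * L := by
    have hsq : (2 ^ J * (512 * Lb)) ^ 2 < (π * L) ^ 2 := by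
      calc (2 ^ J * (512 * Lb)) ^ 2 = 16384 * (16 * 4 ^ J) * Lb ^ 2 := by rw [mul_pow, hM2]; ring
        _ < 16384 * (π ^ 2 * a * L) * Lb ^ 2 := by gcongr
        _ = π ^ 2 * L * (16384 * (a * Lb ^ 2)) := by ring
        _ ≤ π ^ 2 * L * L := by gcongr; linarith only [hreg]
        _ = (π * L) ^ 2 := by ring
    exact lt_of_pow_lt_pow_left₀ 2 (by positivity) hsq
  have hP3 : (2 : ℝ) ^ J ≤ L / 4 := by
    have h1 : 2 ^ J * (512 * 10) ≤ 2 ^ J * (512 * Lb) := by gcongr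
    nlinarith only [hMlt, h1, hπhi, hL0, hM0]
  have hJ1L : (J : ℝ) + 1 ≤ Lb := by
    have h2J1 : (2 : ℝ) ^ (J + 1) ≤ L := by rw [pow_succ]; linarith only [hP3, hL0]
    rw [hLb, Real.le_logb_iff_rpow_le one_lt_two hL0]
    have e : (2 : ℝ) ^ ((J : ℝ) + 1) = 2 ^ (J + 1) := by rw [← Real.rpow_natCast]; push_cast; ring_nf
    rw [e]; exact h2J1
  exact ⟨J, hρsq, hP4, hMlt, hP3, hJ1L⟩

/-- **THE TAYLOR ORDER AT BUDGET `L`.**  For `L ≥ 1024`, `h = ⌈3 log L⌉`: `h ≥ 1`, `h ≤ 2.2·log₂L` and `e^{−h} ≤ 1∕L³`. [bookkeeping] -/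
theorem exists_order_L {L : ℝ} (hL : 1024 ≤ L) :
    ∃ h : ℕ, 1 ≤ h ∧ (h : ℝ) ≤ 2.2 * Real.logb 2 L ∧ Real.exp (-(h : ℝ)) ≤ 1 / L ^ 3 := by
  set Lb : ℝ := Real.logb 2 L with hLb
  have hL0 : 0 < L := by linarith
  have hLb10 : 10 ≤ Lb := by
    rw [hLb, Real.le_logb_iff_rpow_le one_lt_two hL0]
    have e : (2 : ℝ) ^ (10 : ℝ) = 1024 := by norm_num
    rw [e]; exact hL
  have hlog2 : Real.log 2 < 0.6932 := by linarith only [Real.log_two_lt_d9]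
  have hlogL : Real.log L = Lb * Real.log 2 := by
    rw [hLb, Real.logb, div_mul_cancel₀ _ (Real.log_pos one_lt_two).ne']
  have hlogL0 : 0 < Real.log L := Real.log_pos (by linarith only [hL])
  refine ⟨⌈3 * Real.log L⌉₊, Nat.one_le_iff_ne_zero.2 (Nat.pos_iff_ne_zero.1 (Nat.ceil_pos.2 (by positivity))), ?_, ?_⟩
  · have h1 : ((⌈3 * Real.log L⌉₊ : ℕ) : ℝ) < 3 * Real.log L + 1 := Nat.ceil_lt_add_one (by positivity)
    have hLb0 : 0 ≤ Lb := by linarith only [hLb10]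
    have h3 : Real.log L ≤ Lb * 0.6932 := by rw [hlogL]; exact mul_le_mul_of_nonneg_left hlog2.le hLb0
    linarith only [h1, h3, hLb10]
  · have h3 : 3 * Real.log L ≤ ⌈3 * Real.log L⌉₊ := Nat.le_ceil _
    have e3 : Real.exp (3 * Real.log L) = L ^ 3 := by
      rw [show (3 : ℝ) * Real.log L = ((3 : ℕ) : ℝ) * Real.log L by norm_num, Real.exp_nat_mul, Real.exp_log hL0]
    calc Real.exp (-((⌈3 * Real.log L⌉₊ : ℕ) : ℝ)) ≤ Real.exp (-(3 * Real.log L)) := Real.exp_le_exp.2 (by linarith only [h3])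
      _ = 1 / L ^ 3 := by rw [Real.exp_neg, e3, inv_eq_one_div]

/-- **THE LOG-MASS BUDGET.**  With `Λ₂ = log₂L ≥ 10` (`L ≥ 1024`), `a ≥ 0`, `a·Λ₂² ≤ L∕16384`, `J + 1 ≤ 2^J`, `J + 1 ≤ Λ₂`, `2^J·512Λ₂ ≤ πL`,
`h ≤ 2.2Λ₂`, `1 ≤ N ≤ L∕16`: PART B's log-mass plus the correction's, `Λ + log(1 + 2a·N·9^N)`, is `≤ L∕2`
(`Λ = (J+1)log 2 + (6πe²a + h(J+1))log(1 + 10a) + (3πe²a(J+1) + h(2^{J+1} − 1))log 81`). [bookkeeping] -/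
theorem logmass_le {L a h M N Jr : ℝ} (hL : 1024 ≤ L) (ha : 0 ≤ a) (hreg : a * Real.logb 2 L ^ 2 ≤ L / 16384)
    (hJM : Jr + 1 ≤ M) (hJ0 : 0 ≤ Jr) (hJL : Jr + 1 ≤ Real.logb 2 L) (hM : M * (512 * Real.logb 2 L) ≤ π * L)
    (hh : h ≤ 2.2 * Real.logb 2 L) (hN1 : 1 ≤ N) (hN : N ≤ L / 16) :
    (Jr + 1) * Real.log 2 + (6 * π * Real.exp 2 * a + h * (Jr + 1)) * Real.log (1 + 10 * a) +
        (3 * π * Real.exp 2 * a * (Jr + 1) + h * (2 * M - 1)) * Real.log 81 + Real.log (1 + 2 * a * (N * 9 ^ N)) ≤ L / 2 := by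
  set Lb : ℝ := Real.logb 2 L with hLb
  have hL0 : 0 < L := by linarith
  have hLb10 : 10 ≤ Lb := by
    rw [hLb, Real.le_logb_iff_rpow_le one_lt_two hL0]
    have e : (2 : ℝ) ^ (10 : ℝ) = 1024 := by norm_num
    rw [e]; exact hL
  have hLb0 : 0 < Lb := by linarith only [hLb10]
  have hπhi : π < 3.15 := Real.pi_lt_d2
  have hπ0 : 0 < π := Real.pi_pos
  -- numerals
  have hlog2 : Real.log 2 ≤ 0.6932 := by linarith only [Real.log_two_lt_d9]
  have hlog81 : Real.log 81 ≤ 4.853 := by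
    have h1 : Real.log 81 ≤ Real.log (2 ^ 7) := Real.log_le_log (by norm_num) (by norm_num)
    rw [Real.log_pow] at h1; push_cast at h1; linarith only [h1, hlog2]
  have hlog9 : Real.log 9 ≤ 2.773 := by
    have h1 : Real.log 9 ≤ Real.log (2 ^ 4) := Real.log_le_log (by norm_num) (by norm_num)
    rw [Real.log_pow] at h1; push_cast at h1; linarith only [h1, hlog2]
  have he2 : Real.exp 2 ≤ 7.4 := by
    have he1 : Real.exp 1 ≤ 2.7182818286 := Real.exp_one_lt_d9.le
    have he0 : 0 < Real.exp 1 := Real.exp_pos 1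
    have : Real.exp 2 = Real.exp 1 * Real.exp 1 := by rw [← Real.exp_add]; norm_num
    rw [this]; nlinarith only [he1, he0]
  have he20 : 0 < Real.exp 2 := Real.exp_pos 2
  -- the regime in usable forms
  have haLb : a * Lb ≤ L / 163840 := by
    have h1 : a * Lb * 10 ≤ a * Lb * Lb := mul_le_mul_of_nonneg_left hLb10 (mul_nonneg ha hLb0.le)
    nlinarith only [h1, hreg]
  have haL : a ≤ L := by nlinarith only [haLb, hLb10, ha]
  -- `log(1 + 10a) ≤ 10a` and `≤ 1.39 Λ₂`
  have hl10a : Real.log (1 + 10 * a) ≤ 10 * a := by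
    have := Real.log_le_sub_one_of_pos (show 0 < 1 + 10 * a by linarith); linarith
  have hlogL : Real.log L = Lb * Real.log 2 := by
    rw [hLb, Real.logb, div_mul_cancel₀ _ (Real.log_pos one_lt_two).ne']
  have hl10a' : Real.log (1 + 10 * a) ≤ 1.39 * Lb := by
    have h1 : 1 + 10 * a ≤ L ^ 2 := by nlinarith only [haL, hL, ha]
    have h2 : Real.log (1 + 10 * a) ≤ Real.log (L ^ 2) := Real.log_le_log (by linarith) h1
    rw [Real.log_pow, hlogL] at h2; push_cast at h2
    nlinarith only [h2, hlog2, hLb0]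
  -- `log(1 + 2aN9^N) ≤ 2a + N + N log 9`
  have hN0 : 0 < N := by linarith
  have h9N : (1 : ℝ) ≤ 9 ^ N := Real.one_le_rpow (by norm_num) hN0.le
  have hlN : Real.log (1 + 2 * a * (N * 9 ^ N)) ≤ 2 * a + N + N * Real.log 9 := by
    have hprod : 1 + 2 * a * (N * 9 ^ N) ≤ (1 + 2 * a) * ((N + 1) * 9 ^ N) := by
      nlinarith only [ha, hN0, h9N, mul_nonneg (mul_nonneg ha hN0.le) (by linarith only [h9N] : (0 : ℝ) ≤ 9 ^ N)]
    have h1 : Real.log (1 + 2 * a * (N * 9 ^ N)) ≤ Real.log ((1 + 2 * a) * ((N + 1) * 9 ^ N)) :=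
      Real.log_le_log (by positivity) hprod
    rw [Real.log_mul (by positivity) (by positivity), Real.log_mul (by positivity) (by positivity),
      Real.log_rpow (by norm_num)] at h1
    have h2 : Real.log (1 + 2 * a) ≤ 2 * a := by
      have := Real.log_le_sub_one_of_pos (show 0 < 1 + 2 * a by linarith); linarith
    have h3 : Real.log (N + 1) ≤ N := by
      have := Real.log_le_sub_one_of_pos (show 0 < N + 1 by linarith); linarith
    linarith only [h1, h2, h3]
  -- the pieces
  have hM10 : M * 5120 ≤ M * (512 * Lb) := by nlinarith only [hLb10, (by linarith only [hJM, hJ0] : (0 : ℝ) ≤ M)]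
  have hMle : M ≤ L / 1625 := by nlinarith only [hM10, hM, hπhi, hL0]
  have hMLb : M * Lb ≤ π * L / 512 := by
    rw [le_div_iff₀ (by norm_num : (0 : ℝ) < 512)]; linarith only [hM]
  have hT1 : (Jr + 1) * Real.log 2 ≤ L / 2000 := by
    nlinarith only [hJM, hMle, hlog2, hJ0, hL0]
  have hπe : π * Real.exp 2 ≤ 3.15 * 7.4 := mul_le_mul hπhi.le he2 he20.le (by norm_num)
  have hT2a : 6 * π * Real.exp 2 * a * Real.log (1 + 10 * a) ≤ L / 800 := by
    have h1 : 6 * π * Real.exp 2 * a ≤ 139.9 * a := by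
      have := mul_le_mul_of_nonneg_right (show 6 * π * Real.exp 2 ≤ 139.9 by nlinarith only [hπe]) ha
      linarith only [this]
    have h0 : 0 ≤ Real.log (1 + 10 * a) := Real.log_nonneg (by linarith)
    calc 6 * π * Real.exp 2 * a * Real.log (1 + 10 * a) ≤ 139.9 * a * (1.39 * Lb) :=
          mul_le_mul h1 hl10a' h0 (by positivity)
      _ = 194.461 * (a * Lb) := by ring
      _ ≤ L / 800 := by linarith only [haLb, hL0]
  have hT2b : h * (Jr + 1) * Real.log (1 + 10 * a) ≤ L / 600 := by
    have h1 : h * (Jr + 1) ≤ 2.2 * Lb * Lb := mul_le_mul hh hJL (by linarith) (by positivity)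
    have h0 : 0 ≤ Real.log (1 + 10 * a) := Real.log_nonneg (by linarith)
    calc h * (Jr + 1) * Real.log (1 + 10 * a) ≤ 2.2 * Lb * Lb * (10 * a) := mul_le_mul h1 hl10a h0 (by positivity)
      _ = 22 * (a * Lb ^ 2) := by ring
      _ ≤ L / 600 := by linarith only [hreg, hL0]
  have hT3a : 3 * π * Real.exp 2 * a * (Jr + 1) * Real.log 81 ≤ L / 400 := by
    have h1 : 3 * π * Real.exp 2 * a ≤ 69.93 * a := by
      have := mul_le_mul_of_nonneg_right (show 3 * π * Real.exp 2 ≤ 69.93 by nlinarith only [hπe]) ha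
      linarith only [this]
    have h2 : 3 * π * Real.exp 2 * a * (Jr + 1) ≤ 69.93 * a * Lb := mul_le_mul h1 hJL (by linarith) (by positivity)
    calc 3 * π * Real.exp 2 * a * (Jr + 1) * Real.log 81 ≤ 69.93 * a * Lb * 4.853 :=
          mul_le_mul h2 hlog81 (Real.log_nonneg (by norm_num)) (by positivity)
      _ = 339.37029 * (a * Lb) := by ring
      _ ≤ L / 400 := by linarith only [haLb, hL0]
  have hT3b : h * (2 * M - 1) * Real.log 81 ≤ 0.132 * L := by
    have h1 : h * (2 * M - 1) ≤ 2.2 * Lb * (2 * M) := by nlinarith only [hh, hJM, hJ0, hLb0]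
    have hM0 : 0 ≤ M := by linarith only [hJM, hJ0]
    calc h * (2 * M - 1) * Real.log 81 ≤ 2.2 * Lb * (2 * M) * 4.853 :=
          mul_le_mul h1 hlog81 (Real.log_nonneg (by norm_num)) (by positivity)
      _ = 21.3532 * (M * Lb) := by ring
      _ ≤ 21.3532 * (π * L / 512) := by linarith only [hMLb]
      _ ≤ 0.132 * L := by nlinarith only [hπhi, hL0]
  have hT4 : Real.log (1 + 2 * a * (N * 9 ^ N)) ≤ 0.237 * L := by
    have h1 : N * Real.log 9 ≤ (L / 16) * 2.773 := mul_le_mul hN hlog9 (Real.log_nonneg (by norm_num)) (by positivity)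
    have h2 : 2 * a ≤ L / 80000 := by linarith only [haLb, hLb10, ha, mul_le_mul_of_nonneg_left hLb10 ha]
    linarith only [hlN, h1, h2, hN, hL0]
  have e : (Jr + 1) * Real.log 2 + (6 * π * Real.exp 2 * a + h * (Jr + 1)) * Real.log (1 + 10 * a) +
      (3 * π * Real.exp 2 * a * (Jr + 1) + h * (2 * M - 1)) * Real.log 81 + Real.log (1 + 2 * a * (N * 9 ^ N)) =
      (Jr + 1) * Real.log 2 + (6 * π * Real.exp 2 * a * Real.log (1 + 10 * a) + h * (Jr + 1) * Real.log (1 + 10 * a)) +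
      (3 * π * Real.exp 2 * a * (Jr + 1) * Real.log 81 + h * (2 * M - 1) * Real.log 81) + Real.log (1 + 2 * a * (N * 9 ^ N)) := by
    ring
  rw [e]; linarith only [hT1, hT2a, hT2b, hT3a, hT3b, hT4, hL0]

end Summit.QuantumFields.YangMills.Theorems.BalabanUVNodesN19SingleModeMomentLogFreeBudget

end
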